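import Mathlib.LinearAlgebra.Matrix.Permanent
import Mathlib.Probability.Distributions.Gaussian.Real
import Mathlib.MeasureTheory.Constructions.Pi
import Literature.Computability.QuantumComplexity.QuantumAdvantageWave0
import Literature.Computability.Cryptography.StatisticalDistance
import Literature.Computability.Cryptography.SamplingProblems
import Literature.Computability.Cryptography.Postselection
import Literature.Computability.Complexity.BoolEncodings
import Literature.Computability.Complexity.Randomized
import Literature.Computability.Complexity.Oracle
import Literature.Computability.Complexity.Counting
import Literature.Computability.Complexity.PolyHierarchy
import Literature.Computability.Complexity.Nondeterministic
import Literature.Computability.Complexity.ProbabilisticClasses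
import HarnessLib
import HarnessLib.Audit

-- provenance: harness21/H21/H21/Statements/QuantumAdvantage/Sampling.lean @ 60bf3b1 (interim HEAD d8f2665); M5 mechanical rewrite
/-!
# Quantum advantage — hardness of classical sampling (BosonSampling, IQP)

Family `quantum-advantage`, outline CryptoQuantFine §3 (`QuantumAdvantage/Sampling.lean`).
This file states:

* **quantum-advantage.S20** (retired 2026-08-14, see "Retired statements" below) —
  Aaronson–Arkhipov, *The computational complexity of linear optics*, Theory of Computing 9
  (2013), Thm. 1.1 (with the multiplicative-error strengthening stated right after it in §1.2.1
  and proved in §4): an exact — formally: constant-multiplicative-error — *uniform*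
  polynomial-time classical BosonSampling sampler gives `P^{#P} ⊆ BPP^{NP}` (so the polynomial
  hierarchy collapses). The declaration formerly here,
  `PSharpP_subset_BPPRelClass_NP_of_exactBosonSampling`, was mis-stated and has been deleted;
  the corrected statement is `PSharpP_subset_BPPRelClass_NP_of_uniformExactBosonSampling`
  (`ExactBosonSamplingHardness.lean`, proved there from named facts).
* **quantum-advantage.S19** — the *Permanent-of-Gaussians Conjecture* (PGC), AA13 §1.2 /
  Conj. 1.5, in the `|GPE|²_±` form: estimating `|Per X|²` for `X ∼ 𝒩(0,1)_ℂ^{n×n}` to within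
  `± ε · n!` with probability `≥ 1 - δ` is `#P`-hard under BPP-reductions. Open: `def … : Prop`.
* **quantum-advantage.S21** (retired 2026-08-14, see "Retired statements" below) — AA13
  Thm. 1.3 with Cor. 5.9, Conj. 1.5 and the chain of Fig. 2: assuming PGC (for coin-taking
  oracles), a *uniform* approximate classical BosonSampling sampler in the sense of Def. 3.11
  gives `P^{#P} ⊆ BPP^{NP}`. The declaration formerly here,
  `PSharpP_subset_BPPRelClass_NP_of_approxBosonSampling`, was mis-stated and has been deleted;
  the corrected statement is `PSharpP_subset_BPPRelClass_NP_of_uniformApproxBosonSampling`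
  (`BosonSamplingHardness.lean`, proved there from AA13 Thm. 1.3, which is vendored verbatim as
  the named fact `gpeSolvableInFBPPRel_NP_of_uniformApproxBosonSampling`, and oracle-machine
  composition).
* **quantum-advantage.S22** — Bremner–Jozsa–Shepherd, *Classical simulation of commuting quantum
  computations implies collapse of the polynomial hierarchy*, Proc. R. Soc. A 467 (2011),
  Cor. 1: weak classical simulation of uniform IQP families to multiplicative error `c < √2`
  gives `PH = Δ₃ᵖ`.

**Retired statements S20/S21 (2026-08-14).** The two named facts formerly in this file,
`PSharpP_subset_BPPRelClass_NP_of_exactBosonSampling` (S20) and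
`PSharpP_subset_BPPRelClass_NP_of_approxBosonSampling` (S21), were *not* the printed
Aaronson–Arkhipov statements; their prove-seats concluded that they can never be discharged as
stated, and they have been deleted (journal pagination of AA13 below).
*S20* read `(∃ A, IsPPT A id ∧ ∃ c ≥ 1, A.SamplesMultiplicative bosonSamplingProblem c) →
PSharpP ⊆ BPPRelClass NP`. In the tree `IsPPT A id` (= `RandAlg.IsPolyTime`) only *bounds* the
coin budget (`coinLen ≤ poly`, with exactly `coinLen |x|` coins fed and readable by `A.run`), so
the sampler may depend on the possibly non-computable number `coinLen |x|`, i.e. on `O(log |x|)`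
bits of advice; AA13 Thm. 1.1 (p. 149; proof §4.1, p. 178) is about a *uniform* randomised
algorithm, whose number of coins the `BPP^{NP}` machine must know to apply Stockmeyer counting
(Thm. 4.1), and for non-uniform samplers AA13 claim only `P^{#P} ⊆ BPP^{NP}/poly` (p. 150). So
S20 asserted more than the source. Corrected statement (same cite), with the uniform hypothesis
`UniformExactBosonSampling` (exact-polynomial coin budget `∃ q, ∀ n, A.coinLen n = q.eval n`):
`PSharpP_subset_BPPRelClass_NP_of_uniformExactBosonSampling` in
`ExactBosonSamplingHardness.lean`, proved there from named facts along the printed proof, with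
the exact-dyadic orthonormal completion carried out — so for the *exact* case the
discretisation proviso of the design notes below is discharged, not assumed.
*S21* read `PermanentOfGaussiansConjecture → (∃ A, IsPPT A id ∧ ∀ x k, 0 < k →
‖A.samplePMF x k − bosonSamplingProblem x‖ ≤ 1/k) → PSharpP ⊆ BPPRelClass NP` and differed from
the printed chain (Thm. 1.3 p. 152, Cor. 5.9 p. 195, Conj. 1.5 p. 153, Fig. 2 p. 154) in three
respects, the first two making it assert more than AA13 prove: (1) it assumed PGC only for
*coinless* oracles (`PermanentOfGaussiansConjecture`, S19), whereas the `|GPE|²_±` solver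
produced by the proof of Thm. 1.3 is randomised with its guarantee jointly over `X` and the coins
(eqs. (5.96)–(5.97), p. 195), so Fig. 2's step uses PGC for coin-taking oracles; (2) `IsPPT A id`
admits `O(log)`-advice samplers as above, whereas `SampP` (Def. 2.3, p. 162) is uniform;
(3) it constrained the sampler only on the exactly column-orthonormal dyadic instances of
`bosonSamplingProblem`, whereas AA13's oracle (Def. 3.11, p. 174, with §2, p. 161) is
constrained on `p(n)`-bit roundings of every `A ∈ 𝒰_{m,n}` and Lemma 5.8 feeds it Haar-random
`A` (incomparable hypotheses). Corrected statement (same cite):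
`PSharpP_subset_BPPRelClass_NP_of_uniformApproxBosonSampling` in `BosonSamplingHardness.lean`
(hypotheses `PermanentOfGaussiansConjectureRand` and `UniformApproxBosonSampling`), proved there
from AA13 Thm. 1.3/Cor. 5.9 (named fact `gpeSolvableInFBPPRel_NP_of_uniformApproxBosonSampling`)
and `P^{FP^O} ⊆ P^O`. Both companion files import this one, which is why the corrected
statements are not restated here. What remains in this file: the BosonSampling sampling problem
(`bosonSamplingProblem`), the `|GPE|²_±` oracle predicate and PGC (S19), and S22.

**Status of S22 (2026-08-14).** As stated below, S22 is likewise *not* the printed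
Bremner–Jozsa–Shepherd Cor. 1: its hypothesis lets the simulator be non-uniform (`IsPPT A id` only
*bounds* the coin budget, so `coinLen |x|` is `O(log)` advice) and lets the constant `c` depend on
the family (`∀ F, ∃ A c`), whereas BJS's simulators are uniform randomised circuit families (Def. 1,
§2.5 (c)) and their proof of Thm. 2 fixes `c` first (`∃ c, ∀ F`). `IQPPostselection.lean` records
the discrepancy and vendors the corrected statement
`PH_eq_DeltaP_three_of_uniform_iqp_multiplicative` (same cite; `…_of_s22` there shows that S22 as
stated implies it); `IQPPostselectionProofs.lean` reduces the corrected statement to four named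
facts — Aaronson's `PostBQP = PP`, post-BQP error reduction, the Hadamard gadget (BJS Thm. 1) and
Toda's theorem (`PH_eq_DeltaP_three_of_uniform_iqp_multiplicative_of_four_facts`) — the simulation
argument of BJS Thm. 2, `PostBPP ⊆ PP`, `PostBPP ⊆ Δ₃ᵖ` (HHT 1997 Thm. 3.11 (1),
`Complexity/PostBPPDeltaThree.lean`), Stockmeyer's `Δₖ₊₁ ⊆ Σₖ₊₁ ∩ Πₖ₊₁` and `P^{P^O} = P^O` being
theorems. The declaration below is unchanged (name and statement).

## Mathlib / H21

Mathlib has `Matrix.permanent`, `ProbabilityTheory.gaussianReal`, `Measure.pi`, `PMF`, but no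
sampling complexity classes, BosonSampling, IQP, `#P`, `PH` or oracle classes (searched: `boson`,
`SampP`, `IQP`, `permanentOfGaussians`, `SharpP`, `PolynomialHierarchy`). Everything
complexity-theoretic comes from H21: `SamplingProblem`, `SampP`, `RandAlg.samplePMF`,
`RandAlg.ExactlySamples`, `RandAlg.SamplesMultiplicative`, `IQPFamily`, `IsColumnOrthonormal`,
`bosonSamplingPMF`, `dyadicComplex`, `roundMatrix`, `GPEOracleEstimate` (Q6 SamplingProblems),
`gaussianMatrixMeasure` (Wave0), `PMF.tvDist` (C1), `IsPPT` (C2), `Oracle`, `BPPRel`,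
`BPPRelClass` (G01 Oracle), `PSharpP` (G01 Counting), `PH`, `DeltaP` (G01 PolyHierarchy), `NP`
(G01 Nondeterministic), `encodingFinVec`, `encodingFinBool`, `encodingIntBool`,
`Encoding.sigmaBool/pairBool` (G01 encodings).

## Design choices

* **BosonSampling as a `SamplingProblem`.** An input string decodes (`encodingBosonInput`) to
  `⟨n, e, b, entries⟩` with `entries : Fin (n + e) → Fin n → ℤ × ℤ`, read as the
  `(n + e) × n` complex matrix `A i j = dyadicComplex b (entries i j) = (z₁ + z₂ i)/2^b`
  (`m = n + e ≥ n` modes, `n` photons). If decoding fails, or `A` is not column-orthonormal, or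
  `n + e = 0` (no modes; degenerate), the target distribution is the junk value `PMF.pure []`;
  otherwise it is `bosonSamplingPMF A` pushed forward along the outcome encoder
  `encodeBosonOutcome` (ordered mode assignments `Fin n → Fin (n + e)` as lists of binary
  numbers). *Restriction vs. AA13:* Aaronson–Arkhipov (§1.1, Thm. 1.1) allow arbitrary
  column-orthonormal `A ∈ 𝒰_{m,n}` "described to `poly(n)` bits"; we restrict to matrices whose
  entries are *exactly* dyadic Gaussian rationals and which are *exactly* column-orthonormal.
  This is a sub-family of AA13's instances, so hardness of our problem is (formally) the
  *stronger* claim, and the reduction to this sub-family is **not** in AA13: their hard instances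
  are Haar-random unitaries containing a scaled Gaussian block `Y`, completed by `√(1 - YᴴY)`
  (irrational), so transferring Thms. 1.1/1.3 to our family needs an *exact dyadic orthonormal
  completion* lemma (`BᴴB = 1 - ỸᴴỸ` over `ℤ[i][1/2]` for a suitably rounded `Ỹ`) which is
  plausible but not in print. The retired S20/S21 stated the printed theorems *modulo this
  assumed discretisation step*. For the exact case the step is now carried out
  (`ExactBosonSamplingHardness.lean`: an exactly dyadic column-orthonormal Gram completion of an
  integer matrix, `isColumnOrthonormal_gram`), and the corrected S21 instead constrains the
  sampler on roundings of *every* column-orthonormal matrix, as Def. 3.11 does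
  (`IsApproxBosonSampler`, `BosonSamplingHardness.lean`).
* **"Exact" sampling is multiplicative-error sampling (S20).** A `RandAlg` flips fair coins, so
  all its output probabilities are dyadic, whereas `𝒟_A` has non-dyadic probabilities already
  for `A = 1₃` (mass `1/6` on each permutation): the literal hypothesis
  `A.ExactlySamples bosonSamplingProblem` is unsatisfiable and would make S20 vacuous. The tree
  uses (in `UniformExactBosonSampling`, `ExactBosonSamplingHardness.lean`) the form AA13
  themselves point out survives (§1.2.1, remark after Thm. 1.1; §4): sampling to within a
  *constant multiplicative factor* `c ≥ 1` (`RandAlg.SamplesMultiplicative`, the BJS notion).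
  This hypothesis is satisfiable in principle: the nonzero probabilities of a `b`-bit dyadic
  instance are `≥ 4^{-bn}/n!`, so polynomially many coins approximate them to a constant factor.
* **Oracles with long answers (S19).** `PermanentOfGaussiansConjecture` quantifies over all
  `O : Oracle`, including oracles with super-polynomially long answers, outside the adequacy
  caveat of G01's `PRel`/`BPPRel`. This is harmless: truncating such an `O` to the polynomially
  many answer bits a GPE estimate needs gives an `O'` with `GPEOracleSolves O'` and
  `BPPRel O' ⊆ BPPRel O`, so both readings of PGC agree.
* **PGC as an oracle statement (outline R7, review finding 3).** A GPE oracle `O : Oracle` is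
  queried on `⟨n, b, k_ε, k_δ, X̃⟩` (Q6 `encodeGPEQuery`) with `X̃ = roundMatrix b X` the
  Gaussian matrix rounded to `b` bits, and answers an integer `z` (Q6 `GPEOracleEstimate`) read
  as the estimate `z / 4^b` of `|Per X|²`. `GPEOracleSolves O` says: for some polynomial
  precision `b = p(n + k_ε + k_δ)`, the estimate is within `± n!/k_ε` of `|Per X|²` except with
  `gaussianMatrixMeasure n`-probability `< 1/k_δ` (AA13 Problem `|GPE|²_±`, `ε = 1/k_ε`,
  `δ = 1/k_δ`). PGC is then `P^{#P} ⊆ BPP^{O}` for every such `O` — "`|GPE|²_±` is `#P`-hard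
  under BPP (randomised Turing) reductions", exactly the shape consumed by AA13 Thm. 1.3. G01's
  deterministic `IsSharpPHard` is *not* used: a GPE oracle carries a guarantee only on
  Gaussian-random inputs, so reductions to it must sample. AA13's Conj. 1.5 is literally the
  multiplicative form `GPE_×`; the `|GPE|²_±` form used here is the one their Thm. 1.3 needs and
  is equivalent to `GPE_×` under PACC (Wave0 `PermanentAntiConcentrationConjecture`, AA13 §1.2).
* `P^{#P} = BPP^{NP}` in AA13 Thms. 1.1/1.3 means the inclusion `P^{#P} ⊆ BPP^{NP}` (the
  content, via Stockmeyer approximate counting and Toda); the reverse inclusion is classical and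
  not part of the theorem, so we state `⊆`.
-/

open MeasureTheory Matrix Computability Literature.Computability.Complexity Literature.Computability.Complexity.Nondeterministic Literature.Computability.Cryptography

namespace Literature.Computability.QuantumComplexity

/-! ### BosonSampling as a sampling problem over bit strings -/

/-- Boolean encoding of BosonSampling instances `⟨n, e, b, entries⟩`: `n` photons, `m = n + e`
modes, precision `b`, and the integer-pair entries of an `(n + e) × n` matrix (row-major, via
`encodingFinVec` over `encodingIntBool.pairBool encodingIntBool`), assembled with G01's
`sigmaBool`/`pairBool`. (Aaronson–Arkhipov 2013, §1.1 (input `A ∈ 𝒰_{m,n}`); Arora–Barak 2009,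
§0.1.) [cite: AaronsonArkhipov2013, §1.1 (input  A ∈ 𝒰_{m n}] -/
def encodingBosonInput :
    Encoding (Σ n : ℕ, Σ e : ℕ, ℕ × (Fin (n + e) → Fin n → ℤ × ℤ)) Bool :=
  Encoding.sigmaBool fun n => Encoding.sigmaBool fun e =>
    encodingNatBool.pairBool
      (encodingFinVec (encodingFinVec (encodingIntBool.pairBool encodingIntBool) n) (n + e))

/-- The complex `(n + e) × n` matrix described by a BosonSampling instance:
`A i j = dyadicComplex b (entries i j) = (z₁ + z₂ i) / 2^b`. (Aaronson–Arkhipov 2013, §1.1.) [cite: AaronsonArkhipov2013, §1.1] -/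
noncomputable def bosonMatrix (n e b : ℕ) (entries : Fin (n + e) → Fin n → ℤ × ℤ) :
    Matrix (Fin (n + e)) (Fin n) ℂ :=
  Matrix.of fun i j => dyadicComplex b (entries i j)

/-- Boolean encoding of a BosonSampling outcome, an ordered mode assignment `s : Fin n → Fin m`
(photon `i` in mode `s i`), as the list of the binary numbers `s 0, …, s (n-1)`
(`encodingFinVec (encodingFinBool m) n`). (Aaronson–Arkhipov 2013, §1.1, §3.) [cite: AaronsonArkhipov2013, §1.1  §3] -/
def encodeBosonOutcome {m n : ℕ} (s : Fin n → Fin m) : List Bool :=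
  (encodingFinVec (encodingFinBool m) n).encode s

/-- `encodeBosonOutcome` is injective. [folklore] -/
theorem encodeBosonOutcome_injective (m n : ℕ) :
    Function.Injective (encodeBosonOutcome (m := m) (n := n)) :=
  (encodingFinVec (encodingFinBool m) n).encode_injective

open Classical in
/-- The BosonSampling target distribution of a decoded instance `⟨n, e, b, entries⟩`: if
`m = n + e = 0` (no modes) or the matrix `A = bosonMatrix n e b entries` is not column-orthonormal,
the junk value `PMF.pure []`; otherwise `bosonSamplingPMF A` (probabilities `|Per(A_s)|²/n!`)
pushed forward along `encodeBosonOutcome`. (Aaronson–Arkhipov 2013, §1.1, eq. (1.3), §3.) [cite: AaronsonArkhipov2013, §1.1  eq. (1.3] -/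
noncomputable def bosonSamplingKernel (n e b : ℕ) (entries : Fin (n + e) → Fin n → ℤ × ℤ) :
    PMF (List Bool) :=
  if h : n + e = 0 then PMF.pure []
  else
    haveI : NeZero (n + e) := ⟨h⟩
    if IsColumnOrthonormal (bosonMatrix n e b entries) then
      (bosonSamplingPMF (bosonMatrix n e b entries)).map encodeBosonOutcome
    else PMF.pure []

/-- **BosonSampling** as a sampling problem over bit strings: on input `x` decoding
(`encodingBosonInput`) to `⟨n, e, b, entries⟩`, the distribution `bosonSamplingKernel n e b
entries` (= `𝒟_A` for the exactly column-orthonormal dyadic matrix `A`); malformed inputs map to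
the junk value `PMF.pure []`. See the module docstring for the exact-dyadic restriction versus
Aaronson–Arkhipov's `poly(n)`-bit descriptions. (Aaronson–Arkhipov 2013, §1.1 and §3, problem
BosonSampling.) [cite: AaronsonArkhipov2013, §1.1 and §3  problem BosonSampling] -/
noncomputable def bosonSamplingProblem : SamplingProblem := fun x =>
  match encodingBosonInput.decode x with
  | none => PMF.pure []
  | some ⟨n, e, b, entries⟩ => bosonSamplingKernel n e b entries

/-- On a well-formed instance, `bosonSamplingProblem` is the kernel of the decoded data.
(Aaronson–Arkhipov 2013, §1.1.) [cite: AaronsonArkhipov2013, §1.1] -/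
theorem bosonSamplingProblem_encode (n e b : ℕ) (entries : Fin (n + e) → Fin n → ℤ × ℤ) :
    bosonSamplingProblem (encodingBosonInput.encode ⟨n, e, b, entries⟩) =
      bosonSamplingKernel n e b entries := by
  simp only [bosonSamplingProblem, encodingBosonInput.decode_encode]

/-- On a well-formed, column-orthonormal instance with at least one mode, `bosonSamplingProblem`
is the BosonSampling distribution `𝒟_A` pushed forward along the outcome encoder.
(Aaronson–Arkhipov 2013, §1.1, eq. (1.3).) [cite: AaronsonArkhipov2013, §1.1  eq. (1.3] -/
theorem bosonSamplingProblem_encode_of_isColumnOrthonormal (n e b : ℕ) [NeZero (n + e)]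
    (entries : Fin (n + e) → Fin n → ℤ × ℤ)
    (hA : IsColumnOrthonormal (bosonMatrix n e b entries)) :
    bosonSamplingProblem (encodingBosonInput.encode ⟨n, e, b, entries⟩) =
      (bosonSamplingPMF (bosonMatrix n e b entries)).map encodeBosonOutcome := by
  rw [bosonSamplingProblem_encode, bosonSamplingKernel, dif_neg (NeZero.ne (n + e)), if_pos hA]

/-! ### Exact BosonSampling (AA13 Thm. 1.1) — retired

`PSharpP_subset_BPPRelClass_NP_of_exactBosonSampling` (quantum-advantage.S20) was deleted on
2026-08-14: mis-stated relative to Aaronson–Arkhipov 2013, Thm. 1.1 (its sampler hypothesis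
`IsPPT A id` admits `O(log)`-advice samplers, the printed theorem is for uniform ones; module
docstring, "Retired statements"). The corrected statement is
`PSharpP_subset_BPPRelClass_NP_of_uniformExactBosonSampling` in
`ExactBosonSamplingHardness.lean` (same cite), proved there from named facts. -/

/-! ### The Permanent-of-Gaussians Conjecture and approximate BosonSampling (AA13 §1.2) -/

/-- `GPEOracleSolves O`: the oracle `O` solves the Gaussian permanent estimation problem
`|GPE|²_±`. There is a polynomial precision bound `p` such that for all `n` and all accuracy
parameters `k_ε, k_δ ≥ 1` (`ε = 1/k_ε`, `δ = 1/k_δ`), with `b = p (n + k_ε + k_δ)` bits of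
precision, the integer answer `z = GPEOracleEstimate O n b k_ε k_δ X̃` on the rounded matrix
`X̃ = roundMatrix b X`, read as the dyadic `z / 4^b`, satisfies
`| z/4^b - |Per X|² | ≤ ε · n!` except on a set of Gaussian matrices `X ∼ 𝒩(0,1)_ℂ^{n×n}` of
probability `< δ` (AA13 ask for success probability `≥ 1 - δ`, i.e. failure `≤ δ`; the strict
form used here is equivalent up to `k_δ ↦ 2 k_δ`). (Aaronson–Arkhipov 2013, §1.2, Problem
`|GPE|²_±`; outline R7: the rounding precision is part of the query.) [cite: AaronsonArkhipov2013, §1.2  Problem  |GPE|²_±] -/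
def GPEOracleSolves (O : Oracle) : Prop :=
  ∃ p : Polynomial ℕ, ∀ (n kε kδ : ℕ), 0 < kε → 0 < kδ →
    (gaussianMatrixMeasure n).real
        {X | (n.factorial : ℝ) / kε <
          |(GPEOracleEstimate O n (p.eval (n + kε + kδ)) kε kδ
                (roundMatrix (p.eval (n + kε + kδ)) (Matrix.of X)) : ℝ) /
              4 ^ (p.eval (n + kε + kδ)) -
            ‖(Matrix.of X).permanent‖ ^ 2|} < 1 / (kδ : ℝ)

/-- **quantum-advantage.S19** (Permanent-of-Gaussians Conjecture, PGC; Aaronson–Arkhipov 2013,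
§1.2 and Conj. 1.5). Estimating `|Per X|²` of a standard complex Gaussian matrix to within
`± ε · n!` except with probability `< δ` over `X` (AA13: success probability `≥ 1 - δ`;
equivalent up to `δ ↦ δ/2`, cf. `GPEOracleSolves`), in time `poly(n, 1/ε, 1/δ)`, is `#P`-hard
under randomised polynomial-time Turing reductions: for every oracle `O` solving `|GPE|²_±`
(`GPEOracleSolves O`), `P^{#P} ⊆ BPP^{O}`. AA13's Conj. 1.5 is phrased for the multiplicative
variant `GPE_×`, equivalent to this form under PACC (AA13 §1.2; Wave0
`PermanentAntiConcentrationConjecture`); this `|GPE|²_±` form is the one consumed by AA13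
Thm. 1.3. The quantifier ranges over all `O : Oracle`, including ones with super-polynomially
long answers; see the module docstring for why this agrees with the poly-bounded reading.
Open conjecture: stated as a `Prop`. [cite: AaronsonArkhipov2013, §1.2 and Conj. 1.5] -/
@[conjecture] def PermanentOfGaussiansConjecture : Prop :=
  ∀ O : Oracle, GPEOracleSolves O → PSharpP ⊆ BPPRel O

/-! ### Approximate BosonSampling (AA13 Thm. 1.3 under PGC) — retired

`PSharpP_subset_BPPRelClass_NP_of_approxBosonSampling` (quantum-advantage.S21) was deleted on
2026-08-14: mis-stated relative to Aaronson–Arkhipov 2013, Thm. 1.3 / Fig. 2 (PGC assumed only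
for coinless oracles although Thm. 1.3's `|GPE|²_±` solver is randomised; `IsPPT A id` admits
`O(log)`-advice samplers although `SampP`, Def. 2.3, is uniform; sampler constrained only on
the exact-dyadic instance family instead of Def. 3.11's roundings of all `A ∈ 𝒰_{m,n}`; module
docstring, "Retired statements"). The corrected statement is
`PSharpP_subset_BPPRelClass_NP_of_uniformApproxBosonSampling` in `BosonSamplingHardness.lean`
(same cite), proved there from the named fact
`gpeSolvableInFBPPRel_NP_of_uniformApproxBosonSampling` (AA13 Thm. 1.3 with Cor. 5.9). -/

/-- `bosonSamplingProblem ∈ SampP` unfolded (the tree's `SampP`,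
`Cryptography/SamplingProblems.lean`, after Aaronson–Arkhipov 2013, Def. 2.3): some `IsPPT`
algorithm on `⟨x, 1^k⟩` (`k ≥ 1`) outputs a sample within total variation distance `1/k` of
`𝒟_A`. This was the sampler hypothesis of the
retired S21; note that `IsPPT A id` only bounds the coin budget, so this is weaker than AA13's
uniform `SampP` — the uniform hypothesis of the corrected S21 is `UniformApproxBosonSampling`
(`BosonSamplingHardness.lean`). (Aaronson–Arkhipov 2013, Def. 2.3, p. 162.) [cite: AaronsonArkhipovToC2013, Def. 2.3 (p. 162)] -/
theorem bosonSamplingProblem_mem_SampP_iff :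
    bosonSamplingProblem ∈ SampP ↔ ∃ A : RandAlg (List Bool) (List Bool), IsPPT A id ∧
      ∀ x k, 0 < k → (A.samplePMF x k).tvDist (bosonSamplingProblem x) ≤ 1 / (k : ℝ) :=
  Iff.rfl

/-! ### IQP sampling (Bremner–Jozsa–Shepherd 2011) -/

/-- **quantum-advantage.S22** (Bremner–Jozsa–Shepherd, Proc. R. Soc. A 467 (2011), Cor. 1). If the
output distribution of every polynomial-time uniform family of IQP circuits can be weakly
simulated classically — sampled by a probabilistic polynomial-time algorithm — to within
multiplicative error `1 ≤ c < √2`, then `PostBPP = PP` and hence the polynomial hierarchy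
collapses to its third level, `PH = Δ₃ᵖ`. [cite: BremnerJozsaShepherdPRSA2011, Cor. 1] -/
def PH_eq_DeltaP_three_of_iqp_multiplicative : Prop :=
  ∀ (h : ∀ F : IQPFamily, F.IsUniform → ∃ (A : RandAlg (List Bool) (List Bool)) (c : ℝ), 1 ≤ c ∧ c < Real.sqrt 2 ∧ IsPPT A id ∧ A.SamplesMultiplicative F.kernel c),
    PH = DeltaP 3

end Literature.Computability.QuantumComplexity
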